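import Literature.MathematicalPhysics.QuantumFieldTheory.Balaban1983to89.Node00.WilsonActionSecondVariationL2Letters
import Literature.MathematicalPhysics.QuantumFieldTheory.Balaban1983to89.B15Prop1SliceSecondDerivative
import Literature.MathematicalPhysics.QuantumFieldTheory.Balaban1983to89.B11Eq177CriticalFamilyDerivative

/-!
# `Balaban1983to89.B16Ineq19NearFlatSlice` — T. Bałaban, *Large field renormalization. II*, Commun. Math. Phys. **122** (1989) 355–392 [Balaban1989LargeFieldII], (1.7)–(1.9) p. 358 and
# p. 357 «The leading term in the expansion is the quadratic form with the background field identically equal to 1»: THE NEAR-FLAT EDITION (background `U ≠ 1`, `‖U_b − 1‖ ≤ δ`) of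
# dag-n12-w3's flat slice junction `B16Ineq19FlatSliceChart` — `Σ_{box} curl(ιA X)² − 64(d−1)δ·‖X‖² ≤ d²∕ds² A(exp(is·ιA X)·U)∣₀` on dag-n12-c's axial-gauge slice, the `h17` binder with
# `γ₀ = 1`, `Cerr = 64(d−1)δ`, and (1.9) at a near-flat background: `(1 − 64(d−1)δ(3K²+2K⁴))‖X‖² ≤ (3K²+2K⁴)·Q`

Honest framing: statement-level skeleton of published theorems with citation tags; proofs where landed; nothing here is a claim about the Yang–Mills mass gap.

Cell `pub-ymgap` (HUMAN RULINGS D-0062 ∕ D-0149), WIDTH SEAT `pub-ymgap-dag-n12-w2` generation 2 (node N12 = [B15]; key K1⁷ `stmt-QuantumFields-20542`, `--kind proof --supports …`; count-neutral);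
file 2 of 2 of the successor piece (S5) «U2a's flat value + (b) + chart junction» (dag-n12-w4 g0 closing census, INBOX 2026-08-28 l.26037; CLAIM + INTENT-1 l.26254).  File 1 =
`Node00.WilsonActionSecondVariationL2Letters` (the incidence count and the `ℓ²(bonds)` letters for any `SU(N)`).

WHY.  dag-n12-w3's `h17_flat` ∕ `sliceNormSq_le_secondVariation_flat` type [LF-II] (1.7)∕(1.9) along dag-n12-c's slice chart `s ↦ exp(is·ιA X)·U` at `U = 1` with `Cerr = 0`.  At a general
background the slice chain perturbs on the LEFT (`B16Sect1Backgrounds.expMul`), which the U2a package reads through its left chart (p592028): the second variation at `U` differs from the flat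
one by the left-chart letter (b), and by file 1 that error is `64(d−1)δ·Σ_b‖(φ∘ιA X)_b‖²_op = 64(d−1)δ·‖X‖²` (the `ℝ³ ≅ 𝔰𝔲(2)` coordinate is an operator-norm isometry, `ιA` an `ℓ²` isometry).
This is the `Cerr·‖X‖²` slot of the N12 chain's `h17` (`B15Prop1OneSidedIneq17Edition` :395) in the k-level bare-action currency.

WHAT THIS FILE PROVES (theorems only; no `def`, no `instance`, no `sorry`; axioms standard).
§1 `norm_coe_lieSU2Coord` (`‖↑(φ v)‖_op = ‖v‖` for any coordinate `φ` with `↑(φ v) = quatMatrix (ι v)` — `T4QuatExpLog.norm_quatMatrix` + `norm_imQuat`), `expMul_su2Chart_smul_eq_leftChart`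
   (the slice chain's ray IS the left chart at `φ∘A`), ★ `abs_deriv_deriv_wilsonAction4_expMul_su2Chart_sub_one_le` (`|Q^{sl}_U(A) − Q^{sl}_1(A)| ≤ 64(d−1)δ·Σ_b‖A_b‖²` for every `ℝ³`-valued `A`;
   `φ`-free statement), `sum_norm_sq_ιA` (`Σ_b‖ιA X b‖² = ‖X‖²`), `abs_deriv_deriv_wilsonAction4_expMul_su2Chart_ιA_sub_one_le` (`… ≤ 64(d−1)δ·‖X‖²`); SUPPORT-LOCAL editions `…_sub_one_le_local` ∕
   `…_ιA_sub_one_le_local` (the background `δ`-close to `1` only on the plaquettes meeting the support ∕ a free bond — [B16] p.357's `A₀` small ON `Z`).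
§2 ★★ `curlSq_sub_le_secondVariation_nearFlat` — THE NEAR-FLAT (1.7) ALONG THE SLICE: `Σ_{z∈box} Σ_μ Σ_a curl(ιA X)(z)(e₀,μ)² − 64(d−1)δ·‖X‖² ≤ d²∕ds² A(exp(is·ιA X)·U)∣₀` whenever
   `‖U_b − 1‖ ≤ δ` (dag-n12-w3's `sum_box_curl_sq_le_sum_plaq` + `deriv_deriv_wilsonAction4_expMul_su2Chart_one` + §1); ★★ `h17_nearFlat` (the `h17` binder of `ineq19_slice_of_17` for ANY
   pairing realising that second variation: `γ₀ = 1`, `Cerr = 64(d−1)δ`) + SUPPORT-LOCAL twins `curlSq_sub_le_secondVariation_nearFlat_local` ∕ `h17_nearFlat_local`;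
   ★ `sliceNormSq_le_secondVariation_nearFlat` ((1.9) at a near-flat background on the axial-gauge slice, under the
   hypotheses of dag-n12-c's PROVED (1.8) `sliceNormSq_le`); `secondVariation_nearFlat_slice_pos` (nondegeneracy — the U2b `hnd` letter — survives for `64(d−1)δ(3K²+2K⁴) < 1`);
   `hsm_nearFlat_of_le` (the N12 endpoint's `hsm` arithmetic at `γ₀ = 1`: `128(d−1)(3K²+2K⁴)δ ≤ 1 ⇒ 64(d−1)δ ≤ 1∕(2(3K²+2K⁴))`).
§3 THE LITERAL SHAPE OF THE N12 CHAIN'S `h17` (`B15Prop1OneSidedIneq17Edition` :395) FOR `f := wilsonAction4`: `contDiff_sliceFn_wilsonAction4` (dag-n12-c's `sliceFn S T wilsonAction4 U` is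
   `C^ω`: dag-n12-w3's `contDiff_wilsonAction4_expChart` after p592028's linear letter change), `inner_fderiv_rGrad_sliceFn_wilsonAction4_eq` (`⟪X, D(∇ sliceFn)(0)X⟫ = d²∕ds² A(exp(is·ιA X)·U)∣₀`
   — p589765's (S1) bridge with its differentiability binders discharged), ★★★ `h17_nearFlat_sliceFn` ∕ `h17_nearFlat_sliceFn_local`
   (`1·Σ_{box(n+3)(lo−2)}curl² − (64(d−1)δ)‖X‖² ≤ ⟪X, (fderiv ℝ (rGrad S T (sliceFn S T wilsonAction4 U)) 0) X⟫` — the :395 binder verbatim with `f := wilsonAction4`, `ext i := U`, `γ₀ := 1`,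
   `Cerr := 64(d−1)δ`).

HONEST SCOPE — what is NOT claimed.  (i) k-level ∕ UN-AVERAGED bare-action currency, exactly like `B16Ineq19FlatSliceChart` §3: the Wilson action and the slice live on the SAME lattice
`T^{(k)}`; the N12 endpoint's `h17` at `k ≥ 1` concerns the VALUE function `B′ ↦ A(U_{k,Z}(exp(iB′)V_k))` (minimiser inside) and still needs U2b ∕ (J-b) ∕ letter (c) — other pens.  (ii) Bond-wise
`‖U_b − 1‖ ≤ δ` is a HYPOTHESIS (the form print reaches after its gauge transformation, p. 357 «exp iξA₀, with A₀ … < O(1)M⁵R_kε_k»); no gauge fixing is done here.  (iii) `SU(2)` only (the chart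
`su2Chart` of the N12 chain).  Count-neutral; N12 NOT discharged (5∕27 unmoved); finite 𝕋⁴ at fixed ε; R4 closes only the conditional rung `BalabanLadder.UV` — the Yang–Mills mass gap (Clay) is
NOT proved by any of this; nothing continuum ∕ ℝ⁴ ∕ OS.  CONSUMED BY NAME, nothing modified: file 1's `Node00.abs_deriv_deriv_wilsonAction4_leftChart_sub_flat_le_l2(_local)`, p592028 `Node00.expMul_su2Chart_eq_expChart`, p589765
`B15Prop1SliceSecondDerivative.deriv_deriv_smul_eq_inner_rGrad`, dag-n12-w3 `B11Eq177CriticalFamilyDerivative.contDiff_wilsonAction4_expChart` ∕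

`B16Ineq19FlatSliceChart.{expPoint_eq_expSU, exists_lieSU2Coord, expMul_su2Chart_smul_one_eq_expChart, deriv_deriv_wilsonAction4_expMul_su2Chart_one, sum_box_curl_sq_le_sum_plaq}`, dag-n12-c
`B15Prop1SliceCoordinates.{GaugeSlice, ιA, freeBonds, ιA_apply_of_mem, ιA_apply_of_not_mem}` ∕ `B15Prop1SliceIneq18.sliceNormSq_le` ∕ `B15Prop1ChartSU2.su2Chart(_iexp)` ∕ `B16Sect1Backgrounds.expMul`,
`T4QuatExpLog.norm_quatMatrix`, `T4HaarSU2ExpChart.norm_imQuat`, `T4AxialGaugeSmallField.castSite`, `B6TreeGaugePoincare.curl`, `B16Eq18Proof.box`.  0 kit, 0 lit wants.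

## References
* [Balaban1989LargeFieldII] T. Bałaban, Commun. Math. Phys. 122 (1989) 355–392: p. 357, (1.7)–(1.9) p. 358, (1.12)–(1.13) p. 359, (1.16)∕(1.19) p. 360.
* [Balaban1989LargeFieldI] T. Bałaban, Commun. Math. Phys. 122 (1989) 175–202: (1.74) p. 192, Prop. 1 p. 194.
* [Balaban1985BackgroundPropagators] T. Bałaban, Commun. Math. Phys. 99 (1985) 389–434: (3.1) p. 390, (3.10) p. 392.
* [Balaban1985Averaging] T. Bałaban, Commun. Math. Phys. 98 (1985) 17–51: (19)–(20) p. 21.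
-/

noncomputable section

open Finset Filter Topology

namespace Literature.MathematicalPhysics.QuantumFieldTheory.Balaban1983to89.B16Ineq19NearFlatSlice

open GaugeField
open T4AdjointCovarianceUnitary (lieSU expSU coe_expSU specialUnitaryAd)
open Node00 (SU expChart abs_deriv_deriv_wilsonAction4_leftChart_sub_flat_le_l2 abs_deriv_deriv_wilsonAction4_leftChart_sub_flat_le_l2_local)
open scoped Matrix.Norms.L2Operator

/-! ## §1  At `SU(2)` on dag-n12-c's slice: the coordinate is an operator-norm isometry, `ιA` is an `ℓ²` isometry, and the slice chain's ray is the left chart -/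

section SU2Slice

open B16Sect1Backgrounds (expMul)
open B15Prop1ChartSU2 (su2Chart su2Chart_iexp)
open T4CubeChartGnomonic (SU2)
open T4HaarSU2ExpChart (imQuat norm_imQuat)
open Literature.MathematicalPhysics.QuantumLattice (quatMatrix)
open T4QuatExpLog (norm_quatMatrix)
open B16Ineq19FlatSliceChart (expPoint_eq_expSU exists_lieSU2Coord expMul_su2Chart_smul_one_eq_expChart deriv_deriv_wilsonAction4_expMul_su2Chart_one
  sum_box_curl_sq_le_sum_plaq)
open B15Prop1SliceCoordinates (GaugeSlice ιA freeBonds ιA_apply_of_mem ιA_apply_of_not_mem)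
open B15Prop1SliceIneq18 (sliceNormSq_le)
open B15Prop1SliceTaylorCalculus (sliceFn sliceFn_apply rGrad rGrad_def rieszR)
open B15Prop1SliceSecondDerivative (deriv_deriv_smul_eq_inner_rGrad)
open B11Eq177CriticalFamilyDerivative (contDiff_wilsonAction4_expChart)
open Node00 (expMul_su2Chart_eq_expChart)
open T4AxialGaugeSmallField (castSite)
open B6BondElimination (unitVec)
open B6TreeGaugePoincare (curl)
open B16Eq18Proof (box)

variable {P : Params} {k : ℕ} {φ : EuclideanSpace ℝ (Fin 3) →ₗ[ℝ] lieSU (Fin 2)}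

/-- **THE COORDINATE IS AN OPERATOR-NORM ISOMETRY**: `‖↑(φ v)‖ = ‖v‖` for any `φ : ℝ³ → 𝔰𝔲(2)` with `↑(φ v) = quatMatrix (ι v)` (the letters (19) of `φ∘A` are the Euclidean sizes of `A`;
`quatMatrix` is an `L²`-operator-norm isometry, `T4QuatExpLog.norm_quatMatrix`, and `|ι v| = ‖v‖`). [cite: Balaban1985Averaging, (19) p.21; Balaban1989LargeFieldII, (1.19) p.360] -/
theorem norm_coe_lieSU2Coord (hφ : ∀ v, ((φ v : lieSU (Fin 2)) : Matrix (Fin 2) (Fin 2) ℂ) = quatMatrix (imQuat v)) (v : EuclideanSpace ℝ (Fin 3)) :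
    ‖((φ v : lieSU (Fin 2)) : Matrix (Fin 2) (Fin 2) ℂ)‖ = ‖v‖ := by
  rw [hφ, norm_quatMatrix, norm_imQuat]

/-- **THE SLICE CHAIN'S RAY IS THE LEFT CHART AT `φ∘A`**: `expMul su2Chart (s•A) U = (b ↦ expSU((s•(φ∘A))_b)·U_b)` (print multiplies on the LEFT: «exp iη𝐇·U», «V′V₀»).
[cite: Balaban1989LargeFieldII, (1.16) p.360, (1.19) p.360; Balaban1989LargeFieldI, (1.74) p.192] -/
theorem expMul_su2Chart_smul_eq_leftChart (hφ : ∀ v, ((φ v : lieSU (Fin 2)) : Matrix (Fin 2) (Fin 2) ℂ) = quatMatrix (imQuat v))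
    (A : VecField P k (EuclideanSpace ℝ (Fin 3))) (U : GaugeField P k SU2) (s : ℝ) :
    expMul su2Chart (s • A) U = fun b => expSU ((s • fun b => φ (A b)) b) * U b := by
  funext b
  show su2Chart.iexp ((s • A) b) * U b = expSU ((s • fun b => φ (A b)) b) * U b
  rw [Pi.smul_apply, Pi.smul_apply, su2Chart_iexp, expPoint_eq_expSU hφ, map_smul]

/-- ★ **LETTER (b) ALONG THE SLICE CHAIN'S CHART, `ℝ³` CURRENCY**: for every `ℝ³`-valued bond field `A` and every background `U` with `‖U_b − 1‖ ≤ δ` on all bonds,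
`|d²∕ds² A(exp(isA)·U)∣₀ − d²∕ds² A(exp(isA)·1)∣₀| ≤ 64(d−1)δ·Σ_b‖A_b‖²` (the left-chart letter (b) of p592028 in `ℓ²` currency, read through §1's isometry; the statement does not mention `φ`).
[cite: Balaban1989LargeFieldII, p.357, (1.7) p.358; Balaban1985BackgroundPropagators, (3.10) p.392] -/
theorem abs_deriv_deriv_wilsonAction4_expMul_su2Chart_sub_one_le (A : VecField P k (EuclideanSpace ℝ (Fin 3))) (U : GaugeField P k SU2) {δ : ℝ}
    (hδ : ∀ b : PBond P k, ‖((U b : SU2) : Matrix (Fin 2) (Fin 2) ℂ) - 1‖ ≤ δ) :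
    |deriv (deriv fun s : ℝ => wilsonAction4 (expMul su2Chart (s • A) U)) 0
        - deriv (deriv fun s : ℝ => wilsonAction4 (expMul su2Chart (s • A) (1 : GaugeField P k SU2))) 0|
      ≤ 64 * ((P.d : ℝ) - 1) * δ * ∑ b : PBond P k, ‖A b‖ ^ 2 := by
  obtain ⟨φ, hφ⟩ := exists_lieSU2Coord
  have hU : (fun s : ℝ => wilsonAction4 (expMul su2Chart (s • A) U)) = fun t : ℝ => wilsonAction4 (fun b => expSU ((t • fun b => φ (A b)) b) * U b) := by
    funext s
    rw [expMul_su2Chart_smul_eq_leftChart hφ]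
  have h1 : (fun s : ℝ => wilsonAction4 (expMul su2Chart (s • A) (1 : GaugeField P k SU2)))
      = fun s : ℝ => wilsonAction4 (expChart (1 : GaugeField P k (SU 2)) (s • fun b => φ (A b))) := by
    funext s
    rw [expMul_su2Chart_smul_one_eq_expChart hφ]
  rw [hU, h1]
  have h := abs_deriv_deriv_wilsonAction4_leftChart_sub_flat_le_l2 (N := 2) U (fun b => φ (A b)) hδ
  simp only [norm_coe_lieSU2Coord hφ] at h
  exact h

/-- **SUPPORT-LOCAL EDITION** of the previous letter: if the `ℝ³`-valued field `A` vanishes off a bond set `B` and the four bond variables of every plaquette MEETING `B` are within `δ ≥ 0` of `1`,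
then `|d²∕ds² A(exp(isA)·U)∣₀ − d²∕ds² A(exp(isA)·1)∣₀| ≤ 64(d−1)δ·Σ_b‖A_b‖²` — the background need only be near `1` where `A` lives ([B16] p.357: `A₀` small ON THE DOMAIN `Z`; file 1's
`abs_deriv_deriv_wilsonAction4_leftChart_sub_flat_le_l2_local`). [cite: Balaban1989LargeFieldII, p.357, (1.7) p.358; Balaban1985BackgroundPropagators, (3.10) p.392] -/
theorem abs_deriv_deriv_wilsonAction4_expMul_su2Chart_sub_one_le_local (A : VecField P k (EuclideanSpace ℝ (Fin 3))) (U : GaugeField P k SU2) (B : Set (PBond P k))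
    (hA : ∀ b ∉ B, A b = 0) {δ : ℝ} (hδ0 : 0 ≤ δ)
    (hδ : ∀ p : Plaq P k, ((⟨p.src, p.μ⟩ : PBond P k) ∈ B ∨ (⟨p.src.shift p.μ, p.ν⟩ : PBond P k) ∈ B ∨ (⟨p.src.shift p.ν, p.μ⟩ : PBond P k) ∈ B ∨ (⟨p.src, p.ν⟩ : PBond P k) ∈ B) →
      ‖((U ⟨p.src, p.μ⟩ : SU2) : Matrix (Fin 2) (Fin 2) ℂ) - 1‖ ≤ δ ∧ ‖((U ⟨p.src.shift p.μ, p.ν⟩ : SU2) : Matrix (Fin 2) (Fin 2) ℂ) - 1‖ ≤ δ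
        ∧ ‖((U ⟨p.src.shift p.ν, p.μ⟩ : SU2) : Matrix (Fin 2) (Fin 2) ℂ) - 1‖ ≤ δ ∧ ‖((U ⟨p.src, p.ν⟩ : SU2) : Matrix (Fin 2) (Fin 2) ℂ) - 1‖ ≤ δ) :
    |deriv (deriv fun s : ℝ => wilsonAction4 (expMul su2Chart (s • A) U)) 0
        - deriv (deriv fun s : ℝ => wilsonAction4 (expMul su2Chart (s • A) (1 : GaugeField P k SU2))) 0|
      ≤ 64 * ((P.d : ℝ) - 1) * δ * ∑ b : PBond P k, ‖A b‖ ^ 2 := by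
  obtain ⟨φ, hφ⟩ := exists_lieSU2Coord
  have hU : (fun s : ℝ => wilsonAction4 (expMul su2Chart (s • A) U)) = fun t : ℝ => wilsonAction4 (fun b => expSU ((t • fun b => φ (A b)) b) * U b) := by
    funext s
    rw [expMul_su2Chart_smul_eq_leftChart hφ]
  have h1 : (fun s : ℝ => wilsonAction4 (expMul su2Chart (s • A) (1 : GaugeField P k SU2)))
      = fun s : ℝ => wilsonAction4 (expChart (1 : GaugeField P k (SU 2)) (s • fun b => φ (A b))) := by
    funext s
    rw [expMul_su2Chart_smul_one_eq_expChart hφ]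
  rw [hU, h1]
  have hY : ∀ b ∉ B, (fun b => φ (A b)) b = 0 := fun b hb => by simp only [hA b hb, map_zero]
  have h := abs_deriv_deriv_wilsonAction4_leftChart_sub_flat_le_l2_local (N := 2) U (fun b => φ (A b)) B hY hδ0 hδ
  simp only [norm_coe_lieSU2Coord hφ] at h
  exact h

variable [DecidableEq (PBond P k)]

/-- **`ιA` IS AN `ℓ²` ISOMETRY INTO THE BOND FIELDS**: `Σ_{b ∈ T^{(k)}} ‖ιA X (b)‖² = ‖X‖²` (the extension by zero of a coordinate vector of dag-n12-c's `GaugeSlice`; its `PiLp 2` norm).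
[cite: Balaban1989LargeFieldII, (1.7) p.358 («Σ_{b∈Λ₀}|B′(b)|²»), p.359] -/
theorem sum_norm_sq_ιA {𝔤 : Type*} [NormedAddCommGroup 𝔤] [InnerProductSpace ℝ 𝔤] {S : Set (Site P k)} {T : Finset (PBond P k)} (X : GaugeSlice S T 𝔤) :
    ∑ b : PBond P k, ‖ιA S T X b‖ ^ 2 = ‖X‖ ^ 2 := by
  rw [PiLp.norm_sq_eq_of_L2]
  calc ∑ b : PBond P k, ‖ιA S T X b‖ ^ 2 = ∑ b ∈ freeBonds S T, ‖ιA S T X b‖ ^ 2 := by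
        refine (Finset.sum_subset (Finset.subset_univ _) fun b _ hb => ?_).symm
        rw [ιA_apply_of_not_mem X hb, norm_zero, zero_pow two_ne_zero]
    _ = ∑ i : ↥(freeBonds S T), ‖ιA S T X (i : PBond P k)‖ ^ 2 := (Finset.sum_coe_sort (freeBonds S T) _).symm
    _ = ∑ i : ↥(freeBonds S T), ‖X i‖ ^ 2 := Finset.sum_congr rfl fun i _ => by rw [ιA_apply_of_mem X i.2]

/-- The slice version of §1's letter (b): `|d²∕ds² A(exp(is·ιA X)·U)∣₀ − d²∕ds² A(exp(is·ιA X)·1)∣₀| ≤ 64(d−1)δ·‖X‖²` for every coordinate vector `X` of the axial-gauge slice.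
[cite: Balaban1989LargeFieldII, (1.7) p.358, p.357] -/
theorem abs_deriv_deriv_wilsonAction4_expMul_su2Chart_ιA_sub_one_le {S : Set (Site P k)} {T : Finset (PBond P k)}
    (X : GaugeSlice S T (EuclideanSpace ℝ (Fin 3))) (U : GaugeField P k SU2) {δ : ℝ}
    (hδ : ∀ b : PBond P k, ‖((U b : SU2) : Matrix (Fin 2) (Fin 2) ℂ) - 1‖ ≤ δ) :
    |deriv (deriv fun s : ℝ => wilsonAction4 (expMul su2Chart (s • ιA S T X) U)) 0
        - deriv (deriv fun s : ℝ => wilsonAction4 (expMul su2Chart (s • ιA S T X) (1 : GaugeField P k SU2))) 0|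
      ≤ 64 * ((P.d : ℝ) - 1) * δ * ‖X‖ ^ 2 := by
  rw [← sum_norm_sq_ιA X]
  exact abs_deriv_deriv_wilsonAction4_expMul_su2Chart_sub_one_le (ιA S T X) U hδ

/-- **SUPPORT-LOCAL SLICE EDITION**: the coordinate vector's field `ιA X` lives on the free bonds of the chart, so it suffices that the four bond variables of every plaquette MEETING a free bond
are within `δ ≥ 0` of `1`: `|d²∕ds² A(exp(is·ιA X)·U)∣₀ − d²∕ds² A(exp(is·ιA X)·1)∣₀| ≤ 64(d−1)δ·‖X‖²` (the N12 background is near `1` on the box around `Λ^{(k)}`, not on the whole torus).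
[cite: Balaban1989LargeFieldII, (1.7) p.358, p.357, p.359] -/
theorem abs_deriv_deriv_wilsonAction4_expMul_su2Chart_ιA_sub_one_le_local {S : Set (Site P k)} {T : Finset (PBond P k)}
    (X : GaugeSlice S T (EuclideanSpace ℝ (Fin 3))) (U : GaugeField P k SU2) {δ : ℝ} (hδ0 : 0 ≤ δ)
    (hδ : ∀ p : Plaq P k, ((⟨p.src, p.μ⟩ : PBond P k) ∈ freeBonds S T ∨ (⟨p.src.shift p.μ, p.ν⟩ : PBond P k) ∈ freeBonds S T
        ∨ (⟨p.src.shift p.ν, p.μ⟩ : PBond P k) ∈ freeBonds S T ∨ (⟨p.src, p.ν⟩ : PBond P k) ∈ freeBonds S T) →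
      ‖((U ⟨p.src, p.μ⟩ : SU2) : Matrix (Fin 2) (Fin 2) ℂ) - 1‖ ≤ δ ∧ ‖((U ⟨p.src.shift p.μ, p.ν⟩ : SU2) : Matrix (Fin 2) (Fin 2) ℂ) - 1‖ ≤ δ
        ∧ ‖((U ⟨p.src.shift p.ν, p.μ⟩ : SU2) : Matrix (Fin 2) (Fin 2) ℂ) - 1‖ ≤ δ ∧ ‖((U ⟨p.src, p.ν⟩ : SU2) : Matrix (Fin 2) (Fin 2) ℂ) - 1‖ ≤ δ) :
    |deriv (deriv fun s : ℝ => wilsonAction4 (expMul su2Chart (s • ιA S T X) U)) 0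
        - deriv (deriv fun s : ℝ => wilsonAction4 (expMul su2Chart (s • ιA S T X) (1 : GaugeField P k SU2))) 0|
      ≤ 64 * ((P.d : ℝ) - 1) * δ * ‖X‖ ^ 2 := by
  rw [← sum_norm_sq_ιA X]
  exact abs_deriv_deriv_wilsonAction4_expMul_su2Chart_sub_one_le_local (ιA S T X) U (↑(freeBonds S T) : Set (PBond P k))
    (fun b hb => ιA_apply_of_not_mem X (fun h => hb (Finset.mem_coe.mpr h))) hδ0 (fun p hp => hδ p (by simpa only [Finset.mem_coe] using hp))

/-! ## §2  [LF-II] (1.7) ∕ (1.9) along the slice chart AT A NEAR-FLAT BACKGROUND (k-level bare-action currency) -/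

/-- ★★ **THE NEAR-FLAT (1.7) ALONG THE SLICE CHART**: for every background `U` on `T^{(k)}` with `‖U_b − 1‖ ≤ δ` on all bonds, every coordinate vector `X` of dag-n12-c's axial-gauge slice and every
window `box m lo` that does not wrap, `Σ_{z∈box} Σ_μ Σ_a curl(ιA X)(z)(e₀,μ)² − 64(d−1)δ·‖X‖² ≤ d²∕ds² A(exp(is·ιA X)·U)∣₀` — dag-n12-w3's flat curl energy (`sum_box_curl_sq_le_sum_plaq` +
`deriv_deriv_wilsonAction4_expMul_su2Chart_one`) minus the `ℓ²` letter (b): «⟨H B′, Δ₁(ζ₀)H B′⟩ ≧ γ₀Σ_c|∂(…)(c)|² − O(1)(…)²Σ_{b∈Λ₀}|B′(b)|²» with `γ₀ = 1` in the un-averaged currency.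
[cite: Balaban1989LargeFieldII, (1.7) p.358, p.357] -/
theorem curlSq_sub_le_secondVariation_nearFlat (h0 : 0 < P.d) (h1 : 1 < P.d) {m : Fin P.d → ℕ} {lo : Fin P.d → ℤ}
    (hm : ∀ κ, (m κ : ℤ) ≤ P.sitesPerDir k) {S : Set (Site P k)} {T : Finset (PBond P k)}
    (X : GaugeSlice S T (EuclideanSpace ℝ (Fin 3))) (U : GaugeField P k SU2) {δ : ℝ}
    (hδ : ∀ b : PBond P k, ‖((U b : SU2) : Matrix (Fin 2) (Fin 2) ℂ) - 1‖ ≤ δ) :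
    (∑ z ∈ box m lo, ∑ μ : Fin P.d, ∑ a : Fin 3, curl (fun b : (Fin P.d → ℤ) × Fin P.d => ιA S T X (⟨castSite b.1, b.2⟩ : PBond P k) a) z ⟨0, h0⟩ μ ^ 2)
        - 64 * ((P.d : ℝ) - 1) * δ * ‖X‖ ^ 2
      ≤ deriv (deriv fun s : ℝ => wilsonAction4 (expMul su2Chart (s • ιA S T X) U)) 0 := by
  have hflat := sum_box_curl_sq_le_sum_plaq h0 h1 (lo := lo) hm (ιA S T X)
  rw [← deriv_deriv_wilsonAction4_expMul_su2Chart_one] at hflat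
  have hb := (abs_sub_le_iff.1 (abs_deriv_deriv_wilsonAction4_expMul_su2Chart_ιA_sub_one_le X U hδ)).2
  linarith

/-- ★★ **THE `h17` BINDER OF `ineq19_slice_of_17` AT A NEAR-FLAT BACKGROUND, `γ₀ = 1`, `Cerr = 64(d−1)δ`**: for ANY real inner-product space `F`, linear `H : GaugeSlice → F` and `Δ₁ : F → F` whose pairing
REALISES the second variation along the slice chart at the background `U` (`⟪HX, Δ₁HX⟫ = d²∕ds² A(exp(is·ιA X)·U)∣₀`), and `‖U_b − 1‖ ≤ δ` on all bonds:
`1·(Σ_{z∈box(n+3)(lo−2)} Σ_μ Σ_a curl²) − 64(d−1)δ·‖X‖² ≤ ⟪HX, Δ₁HX⟫` — dag-n12-w3's `h17_flat` (`U = 1`, `Cerr = 0`) at `U ≠ 1`. [cite: Balaban1989LargeFieldII, (1.7) p.358, p.357] -/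
theorem h17_nearFlat (h0 : 0 < P.d) (h1 : 1 < P.d) {lo : Fin P.d → ℤ} {n : Fin P.d → ℕ} (hN : ∀ κ, (n κ : ℤ) + 5 < P.sitesPerDir k)
    {S : Set (Site P k)} {T : Finset (PBond P k)}
    {F : Type*} [NormedAddCommGroup F] [InnerProductSpace ℝ F]
    (H : GaugeSlice S T (EuclideanSpace ℝ (Fin 3)) →ₗ[ℝ] F) (Δ₁ : F →ₗ[ℝ] F)
    (U : GaugeField P k SU2) {δ : ℝ} (hδ : ∀ b : PBond P k, ‖((U b : SU2) : Matrix (Fin 2) (Fin 2) ℂ) - 1‖ ≤ δ)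
    (hreal : ∀ X : GaugeSlice S T (EuclideanSpace ℝ (Fin 3)),
      inner ℝ (H X) (Δ₁ (H X)) = deriv (deriv fun s : ℝ => wilsonAction4 (expMul su2Chart (s • ιA S T X) U)) 0)
    (X : GaugeSlice S T (EuclideanSpace ℝ (Fin 3))) :
    1 * (∑ z ∈ box (fun i => n i + 3) (fun i => lo i - 2), ∑ μ : Fin P.d, ∑ a : Fin 3,
        curl (fun b : (Fin P.d → ℤ) × Fin P.d => ιA S T X (⟨castSite b.1, b.2⟩ : PBond P k) a) z ⟨0, h0⟩ μ ^ 2)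
        - (64 * ((P.d : ℝ) - 1) * δ) * ‖X‖ ^ 2
      ≤ inner ℝ (H X) (Δ₁ (H X)) := by
  rw [hreal, one_mul]
  exact curlSq_sub_le_secondVariation_nearFlat h0 h1 (fun κ => by have := hN κ; push_cast; omega) X U hδ

/-- **THE NEAR-FLAT (1.7) ALONG THE SLICE, SUPPORT-LOCAL**: as `curlSq_sub_le_secondVariation_nearFlat`, the background `δ`-close to `1` only on the plaquettes meeting a free bond of the chart.
[cite: Balaban1989LargeFieldII, (1.7) p.358, p.357] -/
theorem curlSq_sub_le_secondVariation_nearFlat_local (h0 : 0 < P.d) (h1 : 1 < P.d) {m : Fin P.d → ℕ} {lo : Fin P.d → ℤ}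
    (hm : ∀ κ, (m κ : ℤ) ≤ P.sitesPerDir k) {S : Set (Site P k)} {T : Finset (PBond P k)}
    (X : GaugeSlice S T (EuclideanSpace ℝ (Fin 3))) (U : GaugeField P k SU2) {δ : ℝ} (hδ0 : 0 ≤ δ)
    (hδ : ∀ p : Plaq P k, ((⟨p.src, p.μ⟩ : PBond P k) ∈ freeBonds S T ∨ (⟨p.src.shift p.μ, p.ν⟩ : PBond P k) ∈ freeBonds S T
        ∨ (⟨p.src.shift p.ν, p.μ⟩ : PBond P k) ∈ freeBonds S T ∨ (⟨p.src, p.ν⟩ : PBond P k) ∈ freeBonds S T) →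
      ‖((U ⟨p.src, p.μ⟩ : SU2) : Matrix (Fin 2) (Fin 2) ℂ) - 1‖ ≤ δ ∧ ‖((U ⟨p.src.shift p.μ, p.ν⟩ : SU2) : Matrix (Fin 2) (Fin 2) ℂ) - 1‖ ≤ δ
        ∧ ‖((U ⟨p.src.shift p.ν, p.μ⟩ : SU2) : Matrix (Fin 2) (Fin 2) ℂ) - 1‖ ≤ δ ∧ ‖((U ⟨p.src, p.ν⟩ : SU2) : Matrix (Fin 2) (Fin 2) ℂ) - 1‖ ≤ δ) :
    (∑ z ∈ box m lo, ∑ μ : Fin P.d, ∑ a : Fin 3, curl (fun b : (Fin P.d → ℤ) × Fin P.d => ιA S T X (⟨castSite b.1, b.2⟩ : PBond P k) a) z ⟨0, h0⟩ μ ^ 2)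
        - 64 * ((P.d : ℝ) - 1) * δ * ‖X‖ ^ 2
      ≤ deriv (deriv fun s : ℝ => wilsonAction4 (expMul su2Chart (s • ιA S T X) U)) 0 := by
  have hflat := sum_box_curl_sq_le_sum_plaq h0 h1 (lo := lo) hm (ιA S T X)
  rw [← deriv_deriv_wilsonAction4_expMul_su2Chart_one] at hflat
  have hb := (abs_sub_le_iff.1 (abs_deriv_deriv_wilsonAction4_expMul_su2Chart_ιA_sub_one_le_local X U hδ0 hδ)).2
  linarith

/-- **THE `h17` BINDER AT A NEAR-FLAT BACKGROUND, SUPPORT-LOCAL**: as `h17_nearFlat`, the background `δ`-close to `1` only on the plaquettes meeting a free bond of the chart.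
[cite: Balaban1989LargeFieldII, (1.7) p.358, p.357] -/
theorem h17_nearFlat_local (h0 : 0 < P.d) (h1 : 1 < P.d) {lo : Fin P.d → ℤ} {n : Fin P.d → ℕ} (hN : ∀ κ, (n κ : ℤ) + 5 < P.sitesPerDir k)
    {S : Set (Site P k)} {T : Finset (PBond P k)}
    {F : Type*} [NormedAddCommGroup F] [InnerProductSpace ℝ F]
    (H : GaugeSlice S T (EuclideanSpace ℝ (Fin 3)) →ₗ[ℝ] F) (Δ₁ : F →ₗ[ℝ] F)
    (U : GaugeField P k SU2) {δ : ℝ} (hδ0 : 0 ≤ δ)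
    (hδ : ∀ p : Plaq P k, ((⟨p.src, p.μ⟩ : PBond P k) ∈ freeBonds S T ∨ (⟨p.src.shift p.μ, p.ν⟩ : PBond P k) ∈ freeBonds S T
        ∨ (⟨p.src.shift p.ν, p.μ⟩ : PBond P k) ∈ freeBonds S T ∨ (⟨p.src, p.ν⟩ : PBond P k) ∈ freeBonds S T) →
      ‖((U ⟨p.src, p.μ⟩ : SU2) : Matrix (Fin 2) (Fin 2) ℂ) - 1‖ ≤ δ ∧ ‖((U ⟨p.src.shift p.μ, p.ν⟩ : SU2) : Matrix (Fin 2) (Fin 2) ℂ) - 1‖ ≤ δ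
        ∧ ‖((U ⟨p.src.shift p.ν, p.μ⟩ : SU2) : Matrix (Fin 2) (Fin 2) ℂ) - 1‖ ≤ δ ∧ ‖((U ⟨p.src, p.ν⟩ : SU2) : Matrix (Fin 2) (Fin 2) ℂ) - 1‖ ≤ δ)
    (hreal : ∀ X : GaugeSlice S T (EuclideanSpace ℝ (Fin 3)),
      inner ℝ (H X) (Δ₁ (H X)) = deriv (deriv fun s : ℝ => wilsonAction4 (expMul su2Chart (s • ιA S T X) U)) 0)
    (X : GaugeSlice S T (EuclideanSpace ℝ (Fin 3))) :
    1 * (∑ z ∈ box (fun i => n i + 3) (fun i => lo i - 2), ∑ μ : Fin P.d, ∑ a : Fin 3,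
        curl (fun b : (Fin P.d → ℤ) × Fin P.d => ιA S T X (⟨castSite b.1, b.2⟩ : PBond P k) a) z ⟨0, h0⟩ μ ^ 2)
        - (64 * ((P.d : ℝ) - 1) * δ) * ‖X‖ ^ 2
      ≤ inner ℝ (H X) (Δ₁ (H X)) := by
  rw [hreal, one_mul]
  exact curlSq_sub_le_secondVariation_nearFlat_local h0 h1 (fun κ => by have := hN κ; push_cast; omega) X U hδ0 hδ

/-- ★ **[LF-II] (1.9) AT A NEAR-FLAT BACKGROUND FOR THE BARE ACTION**: under the hypotheses of dag-n12-c's PROVED (1.8) (`B15Prop1SliceIneq18.sliceNormSq_le`: the box `Λ^{(k)} = castSite″(box n lo)`,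
margins `n_κ + 5 < sitesPerDir k`, sides `n₀, n₁ ≤ K`, the `x₁`-axial tree `G₀`) and `‖U_b − 1‖ ≤ δ` on all bonds, every `X : GaugeSlice S T ℝ³` satisfies
`(1 − 64(d−1)δ·(3K²+2K⁴))·‖X‖² ≤ (3K²+2K⁴)·d²∕ds² A(exp(is·ιA X)·U)∣₀` — coercivity of the second variation on the axial-gauge slice survives at backgrounds with
`64(d−1)δ(3K²+2K⁴) < 1` (dag-n12-w3's `sliceNormSq_le_secondVariation_flat` is the case `δ = 0`). [cite: Balaban1989LargeFieldII, (1.7)–(1.9) p.358, p.357] -/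
theorem sliceNormSq_le_secondVariation_nearFlat (h0 : 0 < P.d) (h1 : 1 < P.d) {lo : Fin P.d → ℤ} {n : Fin P.d → ℕ}
    (hN : ∀ κ, (n κ : ℤ) + 5 < P.sitesPerDir k) {K : ℕ} (hK0 : n ⟨0, h0⟩ ≤ K) (hK1 : n ⟨1, h1⟩ ≤ K)
    {S : Set (Site P k)} {T : Finset (PBond P k)}
    (hS : S = castSite '' (↑(box n lo) : Set (Fin P.d → ℤ)))
    (hT : T = (box n lo).image fun x => (⟨castSite (x - unitVec ⟨0, h0⟩), ⟨0, h0⟩⟩ : PBond P k))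
    (X : GaugeSlice S T (EuclideanSpace ℝ (Fin 3))) (U : GaugeField P k SU2) {δ : ℝ}
    (hδ : ∀ b : PBond P k, ‖((U b : SU2) : Matrix (Fin 2) (Fin 2) ℂ) - 1‖ ≤ δ) :
    (1 - 64 * ((P.d : ℝ) - 1) * δ * (3 * (K : ℝ) ^ 2 + 2 * (K : ℝ) ^ 4)) * ‖X‖ ^ 2
      ≤ (3 * (K : ℝ) ^ 2 + 2 * (K : ℝ) ^ 4) * deriv (deriv fun s : ℝ => wilsonAction4 (expMul su2Chart (s • ιA S T X) U)) 0 := by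
  have h18 := sliceNormSq_le h0 h1 hN hK0 hK1 hS hT X
  have h17 := curlSq_sub_le_secondVariation_nearFlat h0 h1 (m := fun i => n i + 3) (lo := fun i => lo i - 2)
    (fun κ => by have := hN κ; push_cast; omega) X U hδ
  have hC : 0 ≤ 3 * (K : ℝ) ^ 2 + 2 * (K : ℝ) ^ 4 := by positivity
  nlinarith [mul_le_mul_of_nonneg_left h17 hC]

/-- **NONDEGENERACY ON THE SLICE SURVIVES NEAR THE FLAT BACKGROUND**: if moreover `64(d−1)δ(3K²+2K⁴) < 1`, the second variation along the slice chart at `U` is STRICTLY positive at every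
`X ≠ 0` (the `hnd` letter of the U2b theorems at a near-flat background, bare-action currency). [cite: Balaban1989LargeFieldII, (1.9) p.358, p.359 («positive, hence invertible on this subspace»)] -/
theorem secondVariation_nearFlat_slice_pos (h0 : 0 < P.d) (h1 : 1 < P.d) {lo : Fin P.d → ℤ} {n : Fin P.d → ℕ}
    (hN : ∀ κ, (n κ : ℤ) + 5 < P.sitesPerDir k) {K : ℕ} (hK0 : n ⟨0, h0⟩ ≤ K) (hK1 : n ⟨1, h1⟩ ≤ K)
    {S : Set (Site P k)} {T : Finset (PBond P k)}
    (hS : S = castSite '' (↑(box n lo) : Set (Fin P.d → ℤ)))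
    (hT : T = (box n lo).image fun x => (⟨castSite (x - unitVec ⟨0, h0⟩), ⟨0, h0⟩⟩ : PBond P k))
    {X : GaugeSlice S T (EuclideanSpace ℝ (Fin 3))} (hX : X ≠ 0) (U : GaugeField P k SU2) {δ : ℝ}
    (hδ : ∀ b : PBond P k, ‖((U b : SU2) : Matrix (Fin 2) (Fin 2) ℂ) - 1‖ ≤ δ)
    (hsmall : 64 * ((P.d : ℝ) - 1) * δ * (3 * (K : ℝ) ^ 2 + 2 * (K : ℝ) ^ 4) < 1) :
    0 < deriv (deriv fun s : ℝ => wilsonAction4 (expMul su2Chart (s • ιA S T X) U)) 0 := by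
  have h := sliceNormSq_le_secondVariation_nearFlat h0 h1 hN hK0 hK1 hS hT X U hδ
  have hXpos : 0 < ‖X‖ ^ 2 := by positivity
  have hC : 0 ≤ 3 * (K : ℝ) ^ 2 + 2 * (K : ℝ) ^ 4 := by positivity
  have hlhs : 0 < (1 - 64 * ((P.d : ℝ) - 1) * δ * (3 * (K : ℝ) ^ 2 + 2 * (K : ℝ) ^ 4)) * ‖X‖ ^ 2 := mul_pos (by linarith) hXpos
  by_contra hle
  rw [not_lt] at hle
  have : (3 * (K : ℝ) ^ 2 + 2 * (K : ℝ) ^ 4) * deriv (deriv fun s : ℝ => wilsonAction4 (expMul su2Chart (s • ιA S T X) U)) 0 ≤ 0 :=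
    mul_nonpos_of_nonneg_of_nonpos hC hle
  linarith

omit [DecidableEq (PBond P k)] in
/-- **THE `hsm` ARITHMETIC AT `γ₀ = 1`**: the N12 endpoint's smallness letter `Cerr ≤ γ₀∕(2(3K²+2K⁴))` (`B15Prop1OneSidedIneq17Edition` :403) for `Cerr = 64(d−1)δ` holds as soon as
`128(d−1)(3K²+2K⁴)·δ ≤ 1` (`K ≥ 1`). [cite: Balaban1989LargeFieldII, (1.9) p.358, (1.13) p.359 («sufficiently small»)] -/
theorem hsm_nearFlat_of_le {K : ℕ} (hK : 1 ≤ K) {δ : ℝ} (hδ : 128 * ((P.d : ℝ) - 1) * (3 * (K : ℝ) ^ 2 + 2 * (K : ℝ) ^ 4) * δ ≤ 1) :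
    64 * ((P.d : ℝ) - 1) * δ ≤ 1 / (2 * (3 * (K : ℝ) ^ 2 + 2 * (K : ℝ) ^ 4)) := by
  have hK' : (1 : ℝ) ≤ K := by exact_mod_cast hK
  have hC : 0 < 3 * (K : ℝ) ^ 2 + 2 * (K : ℝ) ^ 4 := by positivity
  rw [le_div_iff₀ (by positivity)]
  nlinarith

/-! ## §3  The same in the LITERAL shape of the N12 chain's `h17` letter (`B15Prop1OneSidedIneq17Edition` :395) for `f := wilsonAction4` (k-level) -/

/-- **THE SLICE FUNCTION OF THE BARE ACTION IS SMOOTH**: `B ↦ A(exp(i·ιA B)·U)` (dag-n12-c's `sliceFn S T wilsonAction4 U`) is `C^ω` on the gauge-fixed coordinate space — it is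
dag-n12-w3's `C^ω` map `X ↦ A(U·exp X)` (`contDiff_wilsonAction4_expChart`) after the LINEAR letter change `B ↦ Ad_{U⁻¹}(φ(ιA B))` of p592028 (`expMul_su2Chart_eq_expChart`).
[cite: Balaban1989LargeFieldII, p.359 («the function V′↾_Λ → A(…)»), (1.19) p.360; Balaban1985Variational, (5) p.278] -/
theorem contDiff_sliceFn_wilsonAction4 {S : Set (Site P k)} {T : Finset (PBond P k)} (U : GaugeField P k SU2) :
    ContDiff ℝ ⊤ (sliceFn S T wilsonAction4 U) := by
  haveI : ContinuousSMul ℝ (GaugeSlice S T (EuclideanSpace ℝ (Fin 3))) := IsBoundedSMul.continuousSMul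
  obtain ⟨φ, hφ⟩ := exists_lieSU2Coord
  let L : GaugeSlice S T (EuclideanSpace ℝ (Fin 3)) →ₗ[ℝ] (PBond P k → lieSU (Fin 2)) :=
    { toFun := fun B b => specialUnitaryAd (U b)⁻¹ (φ (ιA S T B b))
      map_add' := fun B B' => by
        funext b
        simp only [map_add, Pi.add_apply]
      map_smul' := fun c B => by
        funext b
        simp only [map_smul, Pi.smul_apply, RingHom.id_apply] }
  have hLB : ∀ B, L B = fun b => specialUnitaryAd (U b)⁻¹ (φ (ιA S T B b)) := fun B => rfl
  have hL : ContDiff ℝ ⊤ (fun B => L B) := (LinearMap.toContinuousLinearMap L).contDiff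
  have hg : sliceFn S T wilsonAction4 U = fun B => wilsonAction4 (expChart U (L B)) := by
    funext B
    rw [sliceFn_apply, expMul_su2Chart_eq_expChart hφ, hLB]
  rw [hg]
  exact (contDiff_wilsonAction4_expChart U).comp hL

/-- The Hessian pairing of the slice function of the bare action is the second variation along the slice chart: `⟪X, D(∇g)(0)X⟫ = d²∕ds² A(exp(is·ιA X)·U)∣₀`,
`g = sliceFn S T wilsonAction4 U` (p589765's (S1) bridge `deriv_deriv_smul_eq_inner_rGrad`, its differentiability binders discharged by `contDiff_sliceFn_wilsonAction4`).
[cite: Balaban1989LargeFieldII, (1.12) p.359, (1.7) p.358] -/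
theorem inner_fderiv_rGrad_sliceFn_wilsonAction4_eq {S : Set (Site P k)} {T : Finset (PBond P k)} (U : GaugeField P k SU2)
    (X : GaugeSlice S T (EuclideanSpace ℝ (Fin 3))) :
    inner ℝ X (fderiv ℝ (rGrad S T (sliceFn S T wilsonAction4 U)) 0 X)
      = deriv (deriv fun s : ℝ => wilsonAction4 (expMul su2Chart (s • ιA S T X) U)) 0 := by
  haveI : ContinuousSMul ℝ (GaugeSlice S T (EuclideanSpace ℝ (Fin 3))) := IsBoundedSMul.continuousSMul
  have hg := contDiff_sliceFn_wilsonAction4 (S := S) (T := T) U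
  have hdiff : ∀ᶠ Y in 𝓝 (0 : GaugeSlice S T (EuclideanSpace ℝ (Fin 3))), DifferentiableAt ℝ (sliceFn S T wilsonAction4 U) Y :=
    Filter.Eventually.of_forall fun Y => (hg.differentiable (by simp)).differentiableAt
  have h2 : DifferentiableAt ℝ (rGrad S T (sliceFn S T wilsonAction4 U)) 0 := by
    rw [rGrad_def]
    have h1 := (hg.contDiffAt (x := (0 : GaugeSlice S T (EuclideanSpace ℝ (Fin 3))))).fderiv_right (m := 1) le_top
    exact (rieszR S T).differentiableAt.comp (0 : GaugeSlice S T (EuclideanSpace ℝ (Fin 3))) (h1.differentiableAt one_ne_zero)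
  rw [← deriv_deriv_smul_eq_inner_rGrad S T X hdiff h2]
  have hfun : (fun s : ℝ => sliceFn S T wilsonAction4 U (s • X)) = fun s : ℝ => wilsonAction4 (expMul su2Chart (s • ιA S T X) U) := by
    funext s
    rw [sliceFn_apply, map_smul]
  rw [hfun]

/-- ★★★ **THE N12 CHAIN'S `h17` LETTER FOR THE BARE ACTION AT A NEAR-FLAT BACKGROUND, IN ITS LITERAL SHAPE** (`B15Prop1OneSidedIneq17Edition` :395 with `f := wilsonAction4`,
`ext := U`, `γ₀ := 1`, `Cerr := 64(d−1)δ`): for every background `U` on `T^{(k)}` with `‖U_b − 1‖ ≤ δ` on all bonds and every coordinate vector `X` of the axial-gauge slice,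
`1·(Σ_{z∈box(n+3)(lo−2)} Σ_μ Σ_a curl(ιA X)(z)(e₀,μ)²) − 64(d−1)δ·‖X‖² ≤ ⟪X, D(∇ sliceFn wilsonAction4 U)(0) X⟫` — the k-level ∕ un-averaged currency of [LF-II] (1.7); at `k ≥ 1`
the letter concerns the value function with the minimiser inside (other pens). [cite: Balaban1989LargeFieldII, (1.7) p.358, p.357, (1.12) p.359] -/
theorem h17_nearFlat_sliceFn (h0 : 0 < P.d) (h1 : 1 < P.d) {lo : Fin P.d → ℤ} {n : Fin P.d → ℕ} (hN : ∀ κ, (n κ : ℤ) + 5 < P.sitesPerDir k)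
    {S : Set (Site P k)} {T : Finset (PBond P k)} (U : GaugeField P k SU2) {δ : ℝ}
    (hδ : ∀ b : PBond P k, ‖((U b : SU2) : Matrix (Fin 2) (Fin 2) ℂ) - 1‖ ≤ δ) (X : GaugeSlice S T (EuclideanSpace ℝ (Fin 3))) :
    1 * (∑ z ∈ box (fun i => n i + 3) (fun i => lo i - 2), ∑ μ : Fin P.d, ∑ a : Fin 3,
        curl (fun b : (Fin P.d → ℤ) × Fin P.d => ιA S T X (⟨castSite b.1, b.2⟩ : PBond P k) a) z ⟨0, h0⟩ μ ^ 2)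
        - (64 * ((P.d : ℝ) - 1) * δ) * ‖X‖ ^ 2
      ≤ inner ℝ X (fderiv ℝ (rGrad S T (sliceFn S T wilsonAction4 U)) 0 X) := by
  rw [inner_fderiv_rGrad_sliceFn_wilsonAction4_eq, one_mul]
  exact curlSq_sub_le_secondVariation_nearFlat h0 h1 (fun κ => by have := hN κ; push_cast; omega) X U hδ

/-- The same, SUPPORT-LOCAL: the background `δ`-close to `1` only on the plaquettes meeting a free bond of the chart. [cite: Balaban1989LargeFieldII, (1.7) p.358, p.357] -/
theorem h17_nearFlat_sliceFn_local (h0 : 0 < P.d) (h1 : 1 < P.d) {lo : Fin P.d → ℤ} {n : Fin P.d → ℕ} (hN : ∀ κ, (n κ : ℤ) + 5 < P.sitesPerDir k)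
    {S : Set (Site P k)} {T : Finset (PBond P k)} (U : GaugeField P k SU2) {δ : ℝ} (hδ0 : 0 ≤ δ)
    (hδ : ∀ p : Plaq P k, ((⟨p.src, p.μ⟩ : PBond P k) ∈ freeBonds S T ∨ (⟨p.src.shift p.μ, p.ν⟩ : PBond P k) ∈ freeBonds S T
        ∨ (⟨p.src.shift p.ν, p.μ⟩ : PBond P k) ∈ freeBonds S T ∨ (⟨p.src, p.ν⟩ : PBond P k) ∈ freeBonds S T) →
      ‖((U ⟨p.src, p.μ⟩ : SU2) : Matrix (Fin 2) (Fin 2) ℂ) - 1‖ ≤ δ ∧ ‖((U ⟨p.src.shift p.μ, p.ν⟩ : SU2) : Matrix (Fin 2) (Fin 2) ℂ) - 1‖ ≤ δ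
        ∧ ‖((U ⟨p.src.shift p.ν, p.μ⟩ : SU2) : Matrix (Fin 2) (Fin 2) ℂ) - 1‖ ≤ δ ∧ ‖((U ⟨p.src, p.ν⟩ : SU2) : Matrix (Fin 2) (Fin 2) ℂ) - 1‖ ≤ δ)
    (X : GaugeSlice S T (EuclideanSpace ℝ (Fin 3))) :
    1 * (∑ z ∈ box (fun i => n i + 3) (fun i => lo i - 2), ∑ μ : Fin P.d, ∑ a : Fin 3,
        curl (fun b : (Fin P.d → ℤ) × Fin P.d => ιA S T X (⟨castSite b.1, b.2⟩ : PBond P k) a) z ⟨0, h0⟩ μ ^ 2)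
        - (64 * ((P.d : ℝ) - 1) * δ) * ‖X‖ ^ 2
      ≤ inner ℝ X (fderiv ℝ (rGrad S T (sliceFn S T wilsonAction4 U)) 0 X) := by
  rw [inner_fderiv_rGrad_sliceFn_wilsonAction4_eq, one_mul]
  exact curlSq_sub_le_secondVariation_nearFlat_local h0 h1 (fun κ => by have := hN κ; push_cast; omega) X U hδ0 hδ


end SU2Slice

end Literature.MathematicalPhysics.QuantumFieldTheory.Balaban1983to89.B16Ineq19NearFlatSlice

end
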